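import Summits.BirchSwinnertonDyer.BirchSwinnertonDyer.Theorems.Rank2Observatory2DescKillSig2XDriver
import HarnessLib

/-!
# KERNEL-2DESC — the 2-ADIC signature certificate for ONE `ℤ₂`-root + a QUADRATIC place (`KillSig2X`), PART 5 of 5:
# the certificate checker `sig2xCheck` and `killValidAt_of_sig2xCheck`
# (rank-2 observatory, cert-1 gen 40; design `b2b-bsdr2-cert-1/…/generics/sig2x/README-SIG2X.md`, census `census/sig2x/`)

HONEST FRAMING: per-curve certified theorems and census instruments; no claim on BSD in rank ≥ 2.
PARTITION: none — rank ≥ 2 data (N3); no r ≤ 1 cell claimed.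

THE CERTIFICATE.  Data: the kill term `(a, b, c; z; t₁, t₂)` of `KillValidAt 2`, a precision `N`, the root
`ε` of `F = x³ + a x² + b x + c` mod `2^N`, the quadratic order `w² = s₁ w + s₀` of the cofactor's field
(`s₁`, `s₀` odd: unramified; `s₁` even: ramified, then internally `w² = 2d·w + 2c'`, `(c', d) = (s₀/2, s₁/2)`, `c'`
odd) and the image `A = p + q·w` of `θ` (`F(A) ≡ 0 mod 2^N`).  `sig2xCheck` verifies: the root data (`rootOK`),
`F(A) ≡ 0`, the reduced class `Z'` at `w` is a unit (after the shape normalisation `w·Z' = 2·Z⋆` at a ramified place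
when `Z'₀` is even), the index `det = q·N(ε − A) = 2^D·(odd)`, that none of the 16 RATIONAL-like patterns matches at
both places (`notRat2x`), and a binary disc walk (`walk2x`, guard `j + B + 2 < N`, `B = max(s, s₂) + 2D (+1)`) whose
every leaf is a mismatch at the root (`outMis8`) or at the quadratic place (`outMisU` / `outMisE`).
`killValidAt_of_sig2xCheck` is its soundness: PART 4's `driver2x` fed with PART 1–3's core / leaf / anchor lemmas.
A row closes a kill piece by `killValidAt_of_sig2xCheck (N := …) (ε := …) (s₁ := …) (s₀ := …) (p := …) (q := …)
(by decide +kernel)`.  Mirror + census: `generics/sig2x/prod/sig2xlean.py` (KP: 233/233 one-root+quadratic kill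
groups certified, KDQ: 1 056/1 056 exact-KILL classes on the 304 such curves, 0/1 072 ALIVE classes accepted).

Integer (pair) arithmetic only; no instances, no `native_decide`, sorry-free.
[cite: Cassels1991LecturesEllipticCurves, §15] [cite: CremonaAlgorithms1997, §3.6]
-/

-- single-conjunct summit: `Summit.BirchSwinnertonDyer.BirchSwinnertonDyer.…` repeats the name by design
set_option linter.dupNamespace false

namespace Summit.BirchSwinnertonDyer.BirchSwinnertonDyer.Rank2Observatory.TwoDescKill

/-! ### Pattern tests -/

/-- UNRAMIFIED quadratic pattern of a RATIONAL-like point `(g, P)`: the parity `s₂ + g` is even and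
`Z'·(P − 2^g Ê₀, −2^g Ê₁)` is a square mod `8`. [cite: CremonaAlgorithms1997, §3.6] -/
def quadPatU (s₁ s₀ : ℤ) (ζ : ℕ × (ℤ × ℤ)) (E : ℤ × ℤ) (g : ℕ) (P : ℤ) : Bool :=
  decide ((ζ.1 + g) % 2 = 0) &&
    isSq8 s₁ s₀ (qmul s₁ s₀ ζ.2 (P - (2 : ℤ) ^ g * E.1, -((2 : ℤ) ^ g * E.2)))

/-- RAMIFIED quadratic pattern of a RATIONAL-like point `(g, P)` (`c` odd, shape data `ζs = (b, s⋆, Z⋆)`):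
impossible when the shape bit is set, else `η^{(s⋆+g) mod 2}·Z⋆·(P − 2^g Ê₀, −2^g Ê₁)` is a square mod `8`.
[cite: CremonaAlgorithms1997, §3.6] -/
def quadPatE (c d : ℤ) (ζs : Bool × ℕ × (ℤ × ℤ)) (E : ℤ × ℤ) (g : ℕ) (P : ℤ) : Bool :=
  !ζs.1 && isSq8 (2 * d) (2 * c)
    (etw c d (ζs.2.1 + g) (qmul (2 * d) (2 * c) ζs.2.2 (P - (2 : ℤ) ^ g * E.1, -((2 : ℤ) ^ g * E.2))))

/-- NOT RATIONAL-LIKE at `2` (root `ρ` + a quadratic pattern test): none of the 16 patterns `g ∈ {1,2,3,4}`,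
`P ∈ {1,3,5,7}` is matched at both places. [folklore] -/
def notRat2x (qpat : ℕ → ℤ → Bool) (ρ : ℤ × ℕ × ℤ) : Bool :=
  ([1, 2, 3, 4] : List ℕ).all fun g => ([1, 3, 5, 7] : List ℤ).all fun P => !(ratPat g P ρ && qpat g P)

/-- Soundness of `notRat2x`. [folklore] -/
theorem notRat2x_spec {qpat : ℕ → ℤ → Bool} {ρ : ℤ × ℕ × ℤ} (h : notRat2x qpat ρ = true) :
    ∀ g ∈ ([1, 2, 3, 4] : List ℕ), ∀ P ∈ ([1, 3, 5, 7] : List ℤ),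
      ratPat g P ρ = true → qpat g P = true → False := by
  intro g hg P hP h₁ h₂
  simp only [notRat2x, List.all_eq_true] at h
  have h' := h g hg P hP
  rw [h₁, h₂] at h'
  exact Bool.noConfusion h'

/-- SHAPE NORMALISATION at a ramified place: from `(s₂, Z')` (`Z'` not divisible by `2`) the shape data
`(b, s⋆, Z⋆)` with `Z⋆₀` odd: `b = false`, `Z⋆ = Z'` if `Z'₀` is odd, else `b = true`, `s⋆ = s₂ + 1` and
`w·Z' = 2·Z⋆`, `Z⋆ = (c·Z'₁, Z'₀/2 + d·Z'₁)`. [folklore] -/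
def shapeData (c d : ℤ) (ζ : ℕ × (ℤ × ℤ)) : Bool × ℕ × (ℤ × ℤ) :=
  if ζ.2.1 % 2 = 0 then (true, ζ.1 + 1, (c * ζ.2.2, ζ.2.1 / 2 + d * ζ.2.2)) else (false, ζ.1, ζ.2)

/-- The two cases of `shapeData`. [folklore] -/
theorem shapeData_spec (c d : ℤ) (ζ : ℕ × (ℤ × ℤ)) :
    shapeData c d ζ = (false, ζ.1, ζ.2) ∨
      (shapeData c d ζ = (true, ζ.1 + 1, (c * ζ.2.2, ζ.2.1 / 2 + d * ζ.2.2)) ∧ (2 : ℤ) ∣ ζ.2.1) := by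
  unfold shapeData
  split_ifs with h
  · exact Or.inr ⟨rfl, Int.dvd_of_emod_eq_zero h⟩
  · exact Or.inl rfl

/-! ### The certificate checkers -/

/-- THE CHECKER at an UNRAMIFIED quadratic place (`s₁`, `s₀` odd); see the module docstring.
[cite: CremonaAlgorithms1997, §3.6] -/
def sig2xCheckU (a b c : ℤ) (z : ℤ × ℤ × ℤ) (t₁ t₂ : ℤ) (N : ℕ) (ε s₁ s₀ p q : ℤ) : Bool :=
  let ρ := rootData 2 N z t₁ t₂ ε
  let G := pg s₁ s₀ a b c (p, q)
  let ζ := psplit N (pmod N (pev s₁ s₀ (p, q) z))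
  let E := pmod N (pev s₁ s₀ (p, q) (0, t₁, t₂))
  let Df := splitPow 2 N (q * ((ε - p) ^ 2 - s₁ * q * (ε - p) - s₀ * q ^ 2))
  let B := max ρ.2.1 ζ.1 + 2 * Df.1
  decide (s₁ % 2 = 1) && decide (s₀ % 2 = 1) && rootOK 2 N a b c ε ρ &&
    decide (G.1 % (2 : ℤ) ^ N = 0) && decide (G.2 % (2 : ℤ) ^ N = 0) &&
    !decide (ζ.2.1 % 2 = 0 ∧ ζ.2.2 % 2 = 0) && unitOK 2 Df.2 &&
    notRat2x (quadPatU s₁ s₀ ζ E) ρ &&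
    walk2x (fun cc j => outMis8 cc j ρ || outMisU s₁ s₀ cc j ζ E) B N N 0 0

/-- THE CHECKER at a RAMIFIED quadratic place (`w² = 2d·w + 2c'`, `c'` odd); see the module docstring.
[cite: CremonaAlgorithms1997, §3.6] -/
def sig2xCheckE (a b c : ℤ) (z : ℤ × ℤ × ℤ) (t₁ t₂ : ℤ) (N : ℕ) (ε c' d p q : ℤ) : Bool :=
  let ρ := rootData 2 N z t₁ t₂ ε
  let G := pg (2 * d) (2 * c') a b c (p, q)
  let ζs := shapeData c' d (psplit N (pmod N (pev (2 * d) (2 * c') (p, q) z)))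
  let E := pmod N (pev (2 * d) (2 * c') (p, q) (0, t₁, t₂))
  let Df := splitPow 2 N (q * ((ε - p) ^ 2 - 2 * d * q * (ε - p) - 2 * c' * q ^ 2))
  let B := max ρ.2.1 ζs.2.1 + 2 * Df.1 + 1
  unitOK 2 c' && rootOK 2 N a b c ε ρ &&
    decide (G.1 % (2 : ℤ) ^ N = 0) && decide (G.2 % (2 : ℤ) ^ N = 0) &&
    unitOK 2 ζs.2.2.1 && unitOK 2 Df.2 &&
    notRat2x (quadPatE c' d ζs E) ρ &&
    walk2x (fun cc j => outMis8 cc j ρ || outMisE c' d cc j ζs E) B N N 0 0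

/-- THE 2-ADIC SIGNATURE CERTIFICATE for one `ℤ₂`-root + a quadratic place: dispatch on the parity of `s₁`
(`w² = s₁ w + s₀`; even `s₁` means the ramified presentation `(c', d) = (s₀/2, s₁/2)`). [cite: CremonaAlgorithms1997, §3.6] -/
def sig2xCheck (a b c : ℤ) (z : ℤ × ℤ × ℤ) (t₁ t₂ : ℤ) (N : ℕ) (ε s₁ s₀ p q : ℤ) : Bool :=
  if s₁ % 2 = 0 then sig2xCheckE a b c z t₁ t₂ N ε (s₀ / 2) (s₁ / 2) p q
  else sig2xCheckU a b c z t₁ t₂ N ε s₁ s₀ p q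

/-! ### Soundness -/

/-- Soundness of `sig2xCheckU`: a certified kill term has no primitive solution. [cite: CremonaAlgorithms1997, §3.6] -/
theorem sig2xCheckU_sound {a b c : ℤ} {z : ℤ × ℤ × ℤ} {t₁ t₂ : ℤ} {N : ℕ} {ε s₁ s₀ p q : ℤ}
    (h : sig2xCheckU a b c z t₁ t₂ N ε s₁ s₀ p q = true) (v : ℤ × ℤ × ℤ × ℤ)
    (hprim : ¬ ((2 : ℤ) ∣ v.1 ∧ (2 : ℤ) ∣ v.2.1 ∧ (2 : ℤ) ∣ v.2.2.1 ∧ (2 : ℤ) ∣ v.2.2.2))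
    (h0 : killQ a b c z t₁ t₂ v = 0) : False := by
  obtain ⟨r₀, r₁, r₂, n⟩ := v
  simp only [sig2xCheckU, Bool.and_eq_true, Bool.not_eq_true', decide_eq_true_eq,
    decide_eq_false_iff_not, rootOK, unitOK] at h
  obtain ⟨⟨⟨⟨⟨⟨⟨⟨hs₁, hs₀⟩, hk⟩, hG₁⟩, hG₂⟩, hZ'⟩, hf⟩, hrat⟩, hwalk⟩ := h
  have relL := lin_rel2x hk.1 h0
  generalize hρ : rootData 2 N z t₁ t₂ ε = ρ at hk relL hrat hwalk
  generalize hE : pmod N (pev s₁ s₀ (p, q) (0, t₁, t₂)) = E at hrat hwalk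
  generalize hζ : psplit N (pmod N (pev s₁ s₀ (p, q) z)) = ζ at hZ' hrat hwalk
  obtain ⟨s₂, Z'⟩ := ζ
  obtain ⟨relQ₁, relQ₂⟩ := quad_rel2x hG₁ hG₂ hζ hE h0
  generalize hw₀ : (zsq a b c z (r₀, r₁, r₂)).1 = w₀ at relL relQ₁ relQ₂
  have hΔ := splitPow_spec 2 N (q * ((ε - p) ^ 2 - s₁ * q * (ε - p) - s₀ * q ^ 2))
  generalize hDf : splitPow 2 N (q * ((ε - p) ^ 2 - s₁ * q * (ε - p) - s₀ * q ^ 2)) = Df at hf hwalk hΔ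
  obtain ⟨D, f⟩ := Df
  simp only [Nat.cast_ofNat] at hΔ hZ' hf hwalk
  have hs₁' : ¬ (2 : ℤ) ∣ s₁ := Int.two_dvd_ne_zero.mpr hs₁
  have hs₀' : ¬ (2 : ℤ) ∣ s₀ := Int.two_dvd_ne_zero.mpr hs₀
  have hu : ¬ (2 : ℤ) ∣ ρ.2.2 := fun hd => hk.2 (Int.emod_eq_zero_of_dvd hd)
  have hfodd : ¬ (2 : ℤ) ∣ f := fun hd => hf (Int.emod_eq_zero_of_dvd hd)
  have hZ'p : ¬ ((2 : ℤ) ∣ Z'.1 ∧ (2 : ℤ) ∣ Z'.2) := fun hh =>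
    hZ' ⟨Int.emod_eq_zero_of_dvd hh.1, Int.emod_eq_zero_of_dvd hh.2⟩
  have hBN := walk2x_guard hwalk
  have hm₁ := le_max_left ρ.2.1 s₂
  have hm₂ := le_max_right ρ.2.1 s₂
  refine driver2x (cw := 0) (dw := 0) (b := false) (B := max ρ.2.1 s₂ + 2 * D) (D := D) (sq := s₂)
    (Zq := Z') (E := E) (R := pev s₁ s₀ (p, q) (r₀, r₁, r₂)) (qpat := quadPatU s₁ s₀ (s₂, Z') E)
    hu (by omega) (by omega) relL ⟨relQ₁, relQ₂⟩ ?_ ?_ ?_ ?_ (notRat2x_spec hrat)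
  · -- index + primitivity
    intro hn hRε hR1 hR2
    obtain ⟨d0, d1, d2⟩ := index12 hΔ hfodd hRε hR1 hR2
    exact hprim ⟨d0, d1, d2, hn⟩
  · -- the quadratic anchor (`sqU`)
    intro hX1 hX2
    by_contra hRR
    refine sqU hs₁' hs₀' hZ'p D _ hRR ⟨?_, ?_⟩
    · have h1 := dvd_add ((pow_dvd_pow (2 : ℤ) (show max ρ.2.1 s₂ + 2 * D + 1 ≤ N by omega)).trans relQ₁) hX1
      rw [sub_add_cancel] at h1
      exact pow_dvd_cancel ((pow_dvd_pow _ (show (2 * D + 1) + s₂ ≤ max ρ.2.1 s₂ + 2 * D + 1 by omega)).trans h1)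
    · have h2 := dvd_add ((pow_dvd_pow (2 : ℤ) (show max ρ.2.1 s₂ + 2 * D + 1 ≤ N by omega)).trans relQ₂) hX2
      rw [sub_add_cancel] at h2
      exact pow_dvd_cancel ((pow_dvd_pow _ (show (2 * D + 1) + s₂ ≤ max ρ.2.1 s₂ + 2 * D + 1 by omega)).trans h2)
  · -- the certified walk
    intro K hK hK2 y hX hR
    refine walk2x_sound (B := max ρ.2.1 s₂ + 2 * D) (N := N)
      (P := fun y => (∃ X : ℤ, (2 : ℤ) ^ N ∣ (2 : ℤ) ^ ρ.2.1 * ρ.2.2 * X ^ 2 - (2 : ℤ) ^ K * (y - ρ.1)) ∧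
        (∃ R' : ℤ × ℤ, (2 : ℤ) ^ N ∣ (2 : ℤ) ^ s₂ * (qmul s₁ s₀ Z' (qmul s₁ s₀ R' R')).1 - (2 : ℤ) ^ K * (y - E.1) ∧
          (2 : ℤ) ^ N ∣ (2 : ℤ) ^ s₂ * (qmul s₁ s₀ Z' (qmul s₁ s₀ R' R')).2 - (2 : ℤ) ^ K * (-E.2)))
      ?_ N 0 0 hwalk y (by simp) ⟨hX, hR⟩
    intro cc j hleaf hj y' hy' hP'
    obtain ⟨hX', hR'⟩ := hP'
    simp only [Bool.or_eq_true] at hleaf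
    rcases hleaf with h8 | hU
    · exact outMis8_sound hu h8 hK hK2 hj hy' hX'
    · exact outMisU_sound hs₁' hs₀' hZ'p hU hK hK2 hj hy' hR'
  · -- the quadratic core lemma in pattern form (`coreU`)
    intro μ g P8 W R' hμg hW1 hW2 hWodd hμN rel₁ rel₂
    have hWp : ¬ ((2 : ℤ) ∣ W.1 ∧ (2 : ℤ) ∣ W.2) := fun hh => hWodd hh.1
    obtain ⟨hpar, hsq⟩ := coreU (W := W) hs₁' hs₀' hZ'p hWp μ s₂ N R' hμN rel₁ rel₂
    obtain ⟨p₁, p₂⟩ := qmul_modEq (s₁ := s₁) (s₀ := s₀) (x := Z') (x' := Z') (y := W)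
      (y' := (P8 - (2 : ℤ) ^ g * E.1, -((2 : ℤ) ^ g * E.2))) (Int.ModEq.refl _) (Int.ModEq.refl _) hW1 hW2
    simp only [quadPatU, Bool.and_eq_true, decide_eq_true_eq]
    exact ⟨by omega, by rw [← isSq8_congr p₁ p₂]; exact hsq⟩

/-- Soundness of `sig2xCheckE`: a certified kill term has no primitive solution. [cite: CremonaAlgorithms1997, §3.6] -/
theorem sig2xCheckE_sound {a b c : ℤ} {z : ℤ × ℤ × ℤ} {t₁ t₂ : ℤ} {N : ℕ} {ε c' d p q : ℤ}
    (h : sig2xCheckE a b c z t₁ t₂ N ε c' d p q = true) (v : ℤ × ℤ × ℤ × ℤ)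
    (hprim : ¬ ((2 : ℤ) ∣ v.1 ∧ (2 : ℤ) ∣ v.2.1 ∧ (2 : ℤ) ∣ v.2.2.1 ∧ (2 : ℤ) ∣ v.2.2.2))
    (h0 : killQ a b c z t₁ t₂ v = 0) : False := by
  obtain ⟨r₀, r₁, r₂, n⟩ := v
  simp only [sig2xCheckE, Bool.and_eq_true, Bool.not_eq_true', decide_eq_true_eq,
    decide_eq_false_iff_not, rootOK, unitOK] at h
  obtain ⟨⟨⟨⟨⟨⟨⟨hc', hk⟩, hG₁⟩, hG₂⟩, hZs⟩, hf⟩, hrat⟩, hwalk⟩ := h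
  have relL := lin_rel2x hk.1 h0
  generalize hρ : rootData 2 N z t₁ t₂ ε = ρ at hk relL hrat hwalk
  generalize hE : pmod N (pev (2 * d) (2 * c') (p, q) (0, t₁, t₂)) = E at hrat hwalk
  generalize hζ : psplit N (pmod N (pev (2 * d) (2 * c') (p, q) z)) = ζ at hZs hrat hwalk
  obtain ⟨s₂, Z'⟩ := ζ
  obtain ⟨relQ₁, relQ₂⟩ := quad_rel2x hG₁ hG₂ hζ hE h0
  generalize hw₀ : (zsq a b c z (r₀, r₁, r₂)).1 = w₀ at relL relQ₁ relQ₂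
  have hΔ := splitPow_spec 2 N (q * ((ε - p) ^ 2 - 2 * d * q * (ε - p) - 2 * c' * q ^ 2))
  generalize hDf : splitPow 2 N (q * ((ε - p) ^ 2 - 2 * d * q * (ε - p) - 2 * c' * q ^ 2)) = Df
    at hf hwalk hΔ
  obtain ⟨D, f⟩ := Df
  have hsd := shapeData_spec c' d (s₂, Z')
  generalize hζs : shapeData c' d (s₂, Z') = ζs at hZs hrat hwalk hsd
  obtain ⟨bb, sE, Zs⟩ := ζs
  simp only [Nat.cast_ofNat, Prod.mk.injEq] at hΔ hZs hf hwalk hsd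
  have hc'odd : ¬ (2 : ℤ) ∣ c' := fun hd => hc' (Int.emod_eq_zero_of_dvd hd)
  have hu : ¬ (2 : ℤ) ∣ ρ.2.2 := fun hd => hk.2 (Int.emod_eq_zero_of_dvd hd)
  have hfodd : ¬ (2 : ℤ) ∣ f := fun hd => hf (Int.emod_eq_zero_of_dvd hd)
  have hZs' : ¬ (2 : ℤ) ∣ Zs.1 := fun hd => hZs (Int.emod_eq_zero_of_dvd hd)
  have hBN := walk2x_guard hwalk
  have hm₁ := le_max_left ρ.2.1 sE
  have hm₂ := le_max_right ρ.2.1 sE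
  -- the shape-normalised quadratic relation
  have relQ : (2 : ℤ) ^ N ∣ (2 : ℤ) ^ sE * (qmul (2 * d) (2 * c') Zs (qmul (2 * d) (2 * c')
        (pev (2 * d) (2 * c') (p, q) (r₀, r₁, r₂)) (pev (2 * d) (2 * c') (p, q) (r₀, r₁, r₂)))).1 -
        (wtw c' d bb (w₀ - n ^ 2 * E.1, -(n ^ 2 * E.2))).1 ∧
      (2 : ℤ) ^ N ∣ (2 : ℤ) ^ sE * (qmul (2 * d) (2 * c') Zs (qmul (2 * d) (2 * c')
        (pev (2 * d) (2 * c') (p, q) (r₀, r₁, r₂)) (pev (2 * d) (2 * c') (p, q) (r₀, r₁, r₂)))).2 -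
        (wtw c' d bb (w₀ - n ^ 2 * E.1, -(n ^ 2 * E.2))).2 := by
    rcases hsd with ⟨rfl, rfl, rfl⟩ | ⟨⟨rfl, rfl, rfl⟩, hev⟩
    · exact ⟨relQ₁, relQ₂⟩
    · exact wmul_rel (by show (2 : ℤ) * (c' * Z'.2) = Z'.2 * (2 * c'); ring)
        (by show (2 : ℤ) * (Z'.1 / 2 + d * Z'.2) = Z'.1 + Z'.2 * (2 * d)
            linear_combination Int.mul_ediv_cancel' hev) relQ₁ relQ₂
  refine driver2x (cw := c') (dw := d) (b := bb) (B := max ρ.2.1 sE + 2 * D + 1) (D := D) (sq := sE)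
    (Zq := Zs) (E := E) (R := pev (2 * d) (2 * c') (p, q) (r₀, r₁, r₂)) (qpat := quadPatE c' d (bb, sE, Zs) E)
    hu (by omega) (by omega) relL relQ ?_ ?_ ?_ ?_ (notRat2x_spec hrat)
  · -- index + primitivity
    intro hn hRε hR1 hR2
    obtain ⟨d0, d1, d2⟩ := index12 hΔ hfodd hRε hR1 hR2
    exact hprim ⟨d0, d1, d2, hn⟩
  · -- the quadratic anchor (`sqE`, first coordinate of `w^b·(…)`)
    intro hX1 hX2
    by_contra hRR
    obtain ⟨w1, -⟩ := wtw_dvd c' d bb (x := (w₀ - n ^ 2 * E.1, -(n ^ 2 * E.2))) hX1 hX2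
    have h1 := dvd_add ((pow_dvd_pow (2 : ℤ) (show max ρ.2.1 sE + 2 * D + 1 + 1 ≤ N by omega)).trans relQ.1) w1
    rw [sub_add_cancel] at h1
    exact sqE hc'odd hZs' D _ hRR
      (pow_dvd_cancel ((pow_dvd_pow _ (show (2 * D + 2) + sE ≤ max ρ.2.1 sE + 2 * D + 1 + 1 by omega)).trans h1))
  · -- the certified walk
    intro K hK hK2 y hX hR
    refine walk2x_sound (B := max ρ.2.1 sE + 2 * D + 1) (N := N)
      (P := fun y => (∃ X : ℤ, (2 : ℤ) ^ N ∣ (2 : ℤ) ^ ρ.2.1 * ρ.2.2 * X ^ 2 - (2 : ℤ) ^ K * (y - ρ.1)) ∧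
        (∃ R' : ℤ × ℤ,
          (2 : ℤ) ^ N ∣ (2 : ℤ) ^ sE * (qmul (2 * d) (2 * c') Zs (qmul (2 * d) (2 * c') R' R')).1 -
              (2 : ℤ) ^ K * (wtw c' d bb (y - E.1, -E.2)).1 ∧
            (2 : ℤ) ^ N ∣ (2 : ℤ) ^ sE * (qmul (2 * d) (2 * c') Zs (qmul (2 * d) (2 * c') R' R')).2 -
              (2 : ℤ) ^ K * (wtw c' d bb (y - E.1, -E.2)).2))
      ?_ N 0 0 hwalk y (by simp) ⟨hX, hR⟩
    intro cc j hleaf hj y' hy' hP'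
    obtain ⟨hX', hR'⟩ := hP'
    simp only [Bool.or_eq_true] at hleaf
    rcases hleaf with h8 | hE'
    · exact outMis8_sound hu h8 hK hK2 hj hy' hX'
    · exact outMisE_sound hc'odd hZs' hE' hK hK2 hj hy' hR'
  · -- the quadratic core lemma in pattern form (`coreE`; with the shape bit set, `shapeE` excludes the case)
    intro μ g P8 W R' hμg hW1 hW2 hWodd hμN rel₁ rel₂
    cases bb with
    | true =>
      exfalso
      refine shapeE (c := c') (d := d) (W := qmul (2 * d) (2 * c') (0, 1) W) hc'odd hZs' ?_ ?_ μ sE N R' hμN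
        rel₁ rel₂
      · exact ⟨W.2 * c', by simp only [qmul]; ring⟩
      · intro h2
        apply hWodd
        have e : W.1 = (qmul (2 * d) (2 * c') (0, 1) W).2 - 2 * (W.2 * d) := by simp only [qmul]; ring
        rw [e]
        exact dvd_sub h2 (Dvd.intro _ rfl)
    | false =>
      have hsq := coreE (c := c') (d := d) (W := W) hc'odd hZs' hWodd μ sE N R' hμN rel₁ rel₂
      rw [etw_congr c' d (show (sE + μ) % 2 = (sE + g) % 2 by omega)] at hsq
      obtain ⟨p₁, p₂⟩ := qmul_modEq (s₁ := 2 * d) (s₀ := 2 * c') (x := Zs) (x' := Zs) (y := W)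
        (y' := (P8 - (2 : ℤ) ^ g * E.1, -((2 : ℤ) ^ g * E.2))) (Int.ModEq.refl _) (Int.ModEq.refl _) hW1 hW2
      obtain ⟨q₁, q₂⟩ := etw_modEq c' d (sE + g) p₁ p₂
      simp only [quadPatE, Bool.not_false, Bool.true_and]
      rw [← isSq8_congr q₁ q₂]
      exact hsq

/-- **Soundness of the 2-adic signature certificate (one root + a quadratic place)**: a certified kill term is
valid at `2`, i.e. `z·ρ² + n²·T` has no nonzero `α`-, `α²`-free solution in `ℤ₂`. [cite: CremonaAlgorithms1997, §3.6] -/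
theorem killValidAt_of_sig2xCheck {a b c : ℤ} {z : ℤ × ℤ × ℤ} {t₁ t₂ : ℤ} {N : ℕ} {ε s₁ s₀ p q : ℤ}
    (h : sig2xCheck a b c z t₁ t₂ N ε s₁ s₀ p q = true) : KillValidAt 2 a b c z t₁ t₂ := fun v hprim h0 => by
  unfold sig2xCheck at h
  split_ifs at h
  · exact sig2xCheckE_sound h v hprim h0
  · exact sig2xCheckU_sound h v hprim h0

end Summit.BirchSwinnertonDyer.BirchSwinnertonDyer.Rank2Observatory.TwoDescKill
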